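import Literature.Analysis.Complex.ThreeChamberSides
import Literature.Analysis.Complex.LogScaleLengthArea
import Mathlib.Analysis.Real.Pi.Bounds
import HarnessLib

/-!
# The three-chamber configuration, IV: circles about the boundary point, and Case I

Topic: Analysis / Complex. Fourth file of the tree's rendering of the proof of Lemma 5.4 of
G. F. Lawler, O. Schramm, W. Werner, Ann. Probab. **32** (2004) ("Suppose for the moment that `α`
intersects `A₁` and `A₂`. Consider a subarc `α' ⊂ α` whose endpoints are in `A₁` and `A₂`, which
is minimal with respect to inclusion. Then … `α'` separates `C(w, r/8)` from `∂D` in `K₃`.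
Consequently … `B` hits `α` before hitting `∂D`. However, by choosing `δ` to be sufficiently
small and invoking conformal invariance of harmonic measure, we may ensure that the latter event
has probability smaller than `c₁`"). We replace the Brownian/harmonic-measure step of [LSW04] by
a deterministic length–area argument (`LogScaleLengthArea.lintegral_inv_le_of_crossings`):

* circles `C(0, u)` about the boundary point `0 ∉ Ω` are never contained in `Ω`
  (`Setup.exists_circleMap_notMem`, winding), so an arc of `C(0, u)` launched inside `Ω` has a
  **first exit** (`Setup.exists_exit`);
* arcs launched from the regions `V_m` near `x` (`Setup.exists_launch`, `Setup.side_circleMap`,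
  `Setup.circleMap_notMem_G`) avoid the gate set `G`;
* **Case I is impossible** (`Setup.caseI_false`): if a Jordan loop `J ⊆ Ω` through `x` consists
  of points of two gates `≠ m` and of far points (`‖ψ - c‖ = ε`) off all gates — the loop
  "gate piece, clean level sub-arc `α'`, gate piece" of [LSW04] — while `ψ(B₀) ⊆ B̄(c, η)` with
  `2^K η ≤ ε`, `K ≥ 400`, then (two-sidedness at `c`, the third gate lies outside `ψ ∘ J`, so
  `ψ(V_m)` lies inside) every arc of `C(0, u)` launched from `V_m`, for `u` in a window of
  logarithmic width `> 1/4`, runs inside `Ω` from a point of `B₀` to a point of `α'`, and the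
  length–area inequality `∫ du/u ≤ 8π²/K < 1/5` is contradicted.

Everything here is proved.

## References

* G. F. Lawler, O. Schramm, W. Werner, Ann. Probab. 32 (2004), proof of Lemma 5.4.
  [LawlerSchrammWerner2004]
-/

noncomputable section

open Set Filter Metric Function Complex Real MeasureTheory
open _root_.Topology
open scoped ENNReal
open Literature.Topology.PlaneTopology

namespace Literature.Analysis.Complex

namespace ThreeChamber

namespace Setup

variable (S : Setup)

/-! ### Polar computations about `0` -/

/-- `‖x‖² = r² + a²`. [folklore] -/
theorem norm_x_sq : ‖S.x‖ ^ 2 = S.r ^ 2 + S.a ^ 2 := by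
  rw [Complex.sq_norm, Complex.normSq_apply, x_re, x_im]; ring

/-- `‖x‖ < 1.42 r`. [folklore] -/
theorem norm_x_lt : ‖S.x‖ < 1.42 * S.r := by
  have h1 : ‖S.x‖ ^ 2 < (1.42 * S.r) ^ 2 := by
    rw [norm_x_sq]; nlinarith [S.a_le, S.a_nonneg, S.r_pos]
  exact lt_of_pow_lt_pow_left₀ 2 (by linarith [S.r_pos]) h1

/-- The point of `C(0, u)` on the ray through `x`: `u e^{i arg x} = (u/‖x‖) x`. [folklore] -/
theorem circleMap_arg_x (u : ℝ) : circleMap 0 u (arg S.x) = ((u / ‖S.x‖ : ℝ) : ℂ) * S.x := by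
  have hx : (‖S.x‖ : ℂ) * exp (arg S.x * I) = S.x := norm_mul_exp_arg_mul_I S.x
  have hx0 : (‖S.x‖ : ℂ) ≠ 0 := by exact_mod_cast S.norm_x_pos.ne'
  rw [circleMap, zero_add]
  calc (u : ℂ) * exp (arg S.x * I)
      = ((u / ‖S.x‖ : ℝ) : ℂ) * ((‖S.x‖ : ℂ) * exp (arg S.x * I)) := by push_cast; field_simp
    _ = ((u / ‖S.x‖ : ℝ) : ℂ) * S.x := by rw [hx]

/-- `side z = Im (x̄ z)`. [folklore] -/
theorem side_eq_im (z : ℂ) : S.side z = ((starRingEnd ℂ) S.x * z).im := by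
  simp [side, mul_im, x_re, x_im]; ring

/-- `x̄ · u e^{i(arg x + φ)} = u ‖x‖ e^{iφ}`. [folklore] -/
theorem conj_x_mul_circleMap (u φ : ℝ) :
    (starRingEnd ℂ) S.x * circleMap 0 u (arg S.x + φ) = ((u * ‖S.x‖ : ℝ) : ℂ) * exp (φ * I) := by
  have hx : (‖S.x‖ : ℂ) * exp (arg S.x * I) = S.x := norm_mul_exp_arg_mul_I S.x
  nth_rw 1 [← hx]
  rw [map_mul, Complex.conj_ofReal, ← Complex.exp_conj, map_mul, Complex.conj_ofReal, Complex.conj_I,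
    circleMap, zero_add]
  calc (‖S.x‖ : ℂ) * exp (↑(arg S.x) * -I) * (↑u * exp (↑(arg S.x + φ) * I))
      = ↑u * ↑‖S.x‖ * (exp (↑(arg S.x) * -I) * exp (↑(arg S.x + φ) * I)) := by ring
    _ = ↑u * ↑‖S.x‖ * exp (φ * I) := by
        rw [← Complex.exp_add]; congr 2; push_cast; ring
    _ = ((u * ‖S.x‖ : ℝ) : ℂ) * exp (φ * I) := by push_cast; ring

/-- **`side (u e^{i(arg x + φ)}) = u ‖x‖ sin φ`.** [folklore] -/
theorem side_circleMap (u φ : ℝ) : S.side (circleMap 0 u (arg S.x + φ)) = u * ‖S.x‖ * Real.sin φ := by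
  rw [side_eq_im, conj_x_mul_circleMap, mul_im, ofReal_re, ofReal_im, exp_ofReal_mul_I_im,
    exp_ofReal_mul_I_re]
  ring

/-- **Points of `C(0, u)`, `u < r`, off the ray through `x` are off the gate set `G`.**
[folklore] -/
theorem circleMap_notMem_G {u φ : ℝ} (hu0 : 0 < u) (hur : u < S.r) (hφ : ∀ n : ℤ, (n : ℝ) * (2 * π) ≠ φ) :
    circleMap 0 u (arg S.x + φ) ∉ S.G := by
  rintro (hseg | hsq)
  · obtain ⟨t, ht, hz⟩ := S.mem_segment_iff.1 hseg
    have key := S.conj_x_mul_circleMap u φ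
    rw [hz, ← mul_assoc, mul_comm ((starRingEnd ℂ) S.x) (t : ℂ), mul_assoc, Complex.conj_mul'] at key
    -- `key : t * ‖x‖² = u ‖x‖ e^{iφ}`
    have key2 : ((t * ‖S.x‖ ^ 2 : ℝ) : ℂ) = ((u * ‖S.x‖ : ℝ) : ℂ) * exp (φ * I) := by
      rw [← key]; push_cast; ring
    have hre := congrArg Complex.re key2
    have him := congrArg Complex.im key2
    rw [ofReal_re, re_ofReal_mul, exp_ofReal_mul_I_re] at hre
    rw [ofReal_im, im_ofReal_mul, exp_ofReal_mul_I_im] at him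
    -- from `him`: `sin φ = 0`; from `hre`: `cos φ ≥ 0`; hence `cos φ = 1`
    have hux : 0 < u * ‖S.x‖ := mul_pos hu0 S.norm_x_pos
    have hsin : Real.sin φ = 0 := by
      rcases mul_eq_zero.1 him.symm with h | h
      · linarith
      · exact h
    have hcos0 : 0 ≤ Real.cos φ := by
      have h2 : 0 ≤ t * ‖S.x‖ ^ 2 := by have := ht.1; positivity
      nlinarith
    have hcos : Real.cos φ = 1 := by
      have h := Real.sin_sq_add_cos_sq φ
      rw [hsin] at h
      nlinarith
    obtain ⟨n, hn⟩ := (Real.cos_eq_one_iff φ).1 hcos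
    exact hφ n hn
  · rw [mem_setOf_eq] at hsq
    have h1 := sqn_le_norm (circleMap 0 u (arg S.x + φ))
    rw [norm_circleMap_zero, abs_of_pos hu0] at h1
    linarith

/-- Points of norm `> √2 r` are off the gate set `G` (all of `G` lies in `{sqn ≤ r}`). [folklore] -/
theorem notMem_G_of_sq_lt {z : ℂ} (hz : 2 * S.r ^ 2 < ‖z‖ ^ 2) : z ∉ S.G := fun h ↦ by
  have h1 := norm_sq_le_two_mul_sqn_sq z
  have h2 : sqn z ≤ S.r := by
    rcases S.sqn_eq_or_of_mem_G h with h | ⟨-, h⟩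
    · exact h.le
    · exact h
  have h3 : sqn z ^ 2 ≤ S.r ^ 2 := pow_le_pow_left₀ (sqn_nonneg z) h2 2
  linarith

/-! ### Circles about `0` leave `Ω` -/

/-- **No circle about `0` lies in `Ω`**: it would wind once around `0 ∉ Ω`, while loops in the
conformal disc `Ω` do not wind around exterior points. [folklore] -/
theorem exists_circleMap_notMem {u : ℝ} (hu : 0 < u) : ∃ θ, circleMap 0 u θ ∉ S.Ω := by
  by_contra h
  push Not at h
  have h01 : circleLoop 0 u 0 = circleLoop 0 u 1 := by
    have hp := periodic_circleMap 0 u 0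
    rw [zero_add] at hp
    show circleMap 0 u (2 * π * 0) = circleMap 0 u (2 * π * 1)
    rw [mul_zero, mul_one, hp]
  have hw : wind (fun t ↦ circleLoop 0 u t - 0) = 0 :=
    wind_sub_eq_zero_of_leftInvOn (S.F_cont.mono ball_subset_closedBall) S.F_maps S.ψ_cont
      S.ψ_maps S.F_ψ (continuous_circleLoop 0 u).continuousOn h01 (fun t _ ↦ h _) S.zero_notMem
  have hw1 : wind (fun t ↦ circleLoop 0 u t - 0) = 1 :=
    wind_circleLoop_sub_of_norm_lt (by simpa using hu)
  rw [hw] at hw1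
  exact zero_ne_one hw1

/-- **First exit of a launched circular arc.** Let `t ↦ u e^{i(θ₁ + σ' t)}` (`σ' = ±1`) start in
`Ω` and suppose its closing piece over `[L, 2π]` lies in `Ω`. Then there is a first exit
parameter `T ∈ (0, L]`: the point at `T` is off `Ω` and the arc over `[0, T)` is in `Ω`.
[folklore] -/
theorem exists_exit {u : ℝ} (hu : 0 < u) (θ₁ σ' : ℝ) (hσ : σ' = 1 ∨ σ' = -1) {L : ℝ}
    (hclose : ∀ s ∈ Icc L (2 * π), circleMap 0 u (θ₁ + σ' * s) ∈ S.Ω)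
    (h0 : circleMap 0 u θ₁ ∈ S.Ω) :
    ∃ T ∈ Ioc 0 L, circleMap 0 u (θ₁ + σ' * T) ∉ S.Ω ∧
      ∀ t ∈ Ico 0 T, circleMap 0 u (θ₁ + σ' * t) ∈ S.Ω := by
  set p : ℝ → ℂ := fun t ↦ circleMap 0 u (θ₁ + σ' * t) with hp
  have hpc : Continuous p := by
    rw [hp]; exact (continuous_circleMap 0 u).comp (by fun_prop)
  set E : Set ℝ := Icc 0 L ∩ p ⁻¹' S.Ωᶜ with hE
  have hEc : IsClosed E := isClosed_Icc.inter (S.isOpen.isClosed_compl.preimage hpc)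
  have hEne : E.Nonempty := by
    by_contra hne
    rw [not_nonempty_iff_eq_empty] at hne
    have hall : ∀ s ∈ Icc 0 (2 * π), p s ∈ S.Ω := by
      intro s hs
      rcases le_or_gt L s with h | h
      · exact hclose s ⟨h, hs.2⟩
      · by_contra hn
        have : s ∈ E := ⟨⟨hs.1, h.le⟩, hn⟩
        rw [hne] at this
        exact this
    obtain ⟨φ, hφ⟩ := S.exists_circleMap_notMem hu
    apply hφ
    have h2π : (0 : ℝ) < 2 * π := by positivity
    set s : ℝ := toIcoMod h2π 0 (σ' * (φ - θ₁)) with hs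
    have hsmem : s ∈ Ico 0 (0 + 2 * π) := toIcoMod_mem_Ico h2π 0 _
    have hs_eq : s = σ' * (φ - θ₁) - toIcoDiv h2π 0 (σ' * (φ - θ₁)) • (2 * π) :=
      (self_sub_toIcoDiv_zsmul h2π 0 _).symm
    have hσ2 : σ' * σ' = 1 := by rcases hσ with rfl | rfl <;> norm_num
    obtain ⟨k, hk⟩ : ∃ k : ℤ, σ' * (toIcoDiv h2π 0 (σ' * (φ - θ₁)) : ℝ) = k := by
      rcases hσ with rfl | rfl
      · exact ⟨toIcoDiv h2π 0 (1 * (φ - θ₁)), by ring⟩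
      · exact ⟨-toIcoDiv h2π 0 (-1 * (φ - θ₁)), by push_cast; ring⟩
    have hangle : θ₁ + σ' * s = φ - k * (2 * π) := by
      rw [hs_eq, zsmul_eq_mul]
      linear_combination (φ - θ₁) * hσ2 - (2 * π) * hk
    have hφeq : circleMap 0 u φ = p s := by
      show circleMap 0 u φ = circleMap 0 u (θ₁ + σ' * s)
      rw [hangle]
      exact ((periodic_circleMap 0 u).sub_int_mul_eq k).symm
    rw [hφeq]
    exact hall s ⟨hsmem.1, by linarith [hsmem.2]⟩
  have hbdd : BddBelow E := ⟨0, fun t ht ↦ ht.1.1⟩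
  have hTE : sInf E ∈ E := hEc.csInf_mem hEne hbdd
  have hTle : ∀ t ∈ E, sInf E ≤ t := fun t ht ↦ csInf_le hbdd ht
  have hT0 : sInf E ≠ 0 := by
    intro h
    apply hTE.2
    show p (sInf E) ∈ S.Ω
    rw [h, hp]
    simpa using h0
  refine ⟨sInf E, ⟨lt_of_le_of_ne hTE.1.1 (Ne.symm hT0), hTE.1.2⟩, hTE.2, fun t ht ↦ ?_⟩
  by_contra hn
  have : t ∈ E := ⟨⟨ht.1, ht.2.le.trans hTE.1.2⟩, hn⟩
  exact absurd (hTle t this) (not_le.2 ht.2)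

/-! ### Launching near `x` -/

/-- **Launch window inside `Q'`**: for `0.52 r < u < r`, the points `u e^{i(arg x + s)}`,
`|s| ≤ δ`, lie in `B₀ ∩ Q'` for some `δ ∈ (0, 1)`. [folklore] -/
theorem exists_launch {u : ℝ} (hu1 : 0.52 * S.r < u) (hu2 : u < S.r) :
    ∃ δ ∈ Ioo (0 : ℝ) 1, ∀ s ∈ Icc (-δ) δ, circleMap 0 u (arg S.x + s) ∈ S.B₀ ∩ {z | sqn z < S.r} := by
  have hr := S.r_pos
  have hxn := S.norm_x_pos
  have hxlt := S.norm_x_lt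
  have hxge := S.norm_x_ge
  set f : ℝ → ℂ := fun s ↦ circleMap 0 u (arg S.x + s) with hf
  have hfc : Continuous f := by rw [hf]; exact (continuous_circleMap 0 u).comp (by fun_prop)
  have hO : IsOpen (S.B₀ ∩ {z : ℂ | sqn z < S.r}) :=
    S.isOpen_B₀.inter (isOpen_lt continuous_sqn continuous_const)
  have hux : 0 ≤ u / ‖S.x‖ := div_nonneg (by linarith) hxn.le
  have hux1 : u / ‖S.x‖ < 1 := (div_lt_one hxn).2 (by linarith)
  have hf0 : f 0 ∈ S.B₀ ∩ {z : ℂ | sqn z < S.r} := by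
    have h0 : f 0 = ((u / ‖S.x‖ : ℝ) : ℂ) * S.x := by
      show circleMap 0 u (arg S.x + 0) = _; rw [add_zero, circleMap_arg_x]
    rw [h0]
    constructor
    · show ((u / ‖S.x‖ : ℝ) : ℂ) * S.x ∈ ball S.x (9 * S.r / 10)
      rw [mem_ball, dist_eq_norm, show ((u / ‖S.x‖ : ℝ) : ℂ) * S.x - S.x =
        ((u / ‖S.x‖ - 1 : ℝ) : ℂ) * S.x by push_cast; ring, norm_mul, Complex.norm_real,
        Real.norm_eq_abs, abs_of_neg (by linarith), show -(u / ‖S.x‖ - 1) * ‖S.x‖ = ‖S.x‖ - u by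
          field_simp; ring]
      linarith
    · show sqn (((u / ‖S.x‖ : ℝ) : ℂ) * S.x) < S.r
      rw [S.sqn_smul_x hux]
      nlinarith
  obtain ⟨ε₀, hε₀, hball⟩ := Metric.mem_nhds_iff.1 (hfc.continuousAt.preimage_mem_nhds (hO.mem_nhds hf0))
  refine ⟨min (ε₀ / 2) (1 / 2), ⟨lt_min (by linarith) (by norm_num), lt_of_le_of_lt (min_le_right _ _)
    (by norm_num)⟩, fun s hs ↦ hball ?_⟩
  rw [mem_ball, dist_zero_right, Real.norm_eq_abs, abs_lt]
  have := min_le_left (ε₀ / 2) (1 / 2 : ℝ)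
  constructor <;> linarith [hs.1, hs.2]

/-- **Launch point outside `Q̄'`**: for `1.42 r < u < 1.9 r`, `u e^{i arg x} ∈ V_0`. [folklore] -/
theorem circleMap_arg_x_mem_V {u : ℝ} (hu1 : 1.42 * S.r < u) (hu2 : u < 1.9 * S.r) :
    circleMap 0 u (arg S.x) ∈ S.V 0 := by
  have hr := S.r_pos
  have hxn := S.norm_x_pos
  have hxlt := S.norm_x_lt
  have hxge := S.norm_x_ge
  rw [circleMap_arg_x]
  have hux1 : 1 < u / ‖S.x‖ := (one_lt_div hxn).2 (by linarith)
  constructor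
  · show ((u / ‖S.x‖ : ℝ) : ℂ) * S.x ∈ ball S.x (9 * S.r / 10)
    rw [mem_ball, dist_eq_norm, show ((u / ‖S.x‖ : ℝ) : ℂ) * S.x - S.x =
      ((u / ‖S.x‖ - 1 : ℝ) : ℂ) * S.x by push_cast; ring, norm_mul, Complex.norm_real,
      Real.norm_eq_abs, abs_of_pos (by linarith), show (u / ‖S.x‖ - 1) * ‖S.x‖ = u - ‖S.x‖ by
        field_simp]
    linarith
  · show S.r < (((u / ‖S.x‖ : ℝ) : ℂ) * S.x).re
    rw [re_ofReal_mul, x_re]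
    nlinarith

/-! ### The length–area contradiction -/

/-- `∫_{(a,b)} du/u ≥ (b - a)/b`. [folklore] -/
theorem lintegral_inv_Ioo_ge {a b : ℝ} (ha : 0 < a) (hab : a < b) :
    ENNReal.ofReal ((b - a) / b) ≤ ∫⁻ u in Ioo a b, ENNReal.ofReal u⁻¹ := by
  have hb : 0 < b := ha.trans hab
  calc ENNReal.ofReal ((b - a) / b) = ENNReal.ofReal b⁻¹ * volume (Ioo a b) := by
        rw [Real.volume_Ioo, ← ENNReal.ofReal_mul (inv_nonneg.2 hb.le), div_eq_inv_mul]
    _ = ∫⁻ _ in Ioo a b, ENNReal.ofReal b⁻¹ := (setLIntegral_const _ _).symm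
    _ ≤ ∫⁻ u in Ioo a b, ENNReal.ofReal u⁻¹ := by
        refine setLIntegral_mono (measurable_inv.ennreal_ofReal) fun u hu ↦ ?_
        exact ENNReal.ofReal_le_ofReal (inv_anti₀ (ha.trans hu.1) hu.2.le)

/-- The numerical contradiction: `(b - a)/b ≥ ¼ > 8π²/K` for `K ≥ 400`. [folklore] -/
theorem false_of_ratio {q : ℝ} {K : ℕ} (hK : 400 ≤ K) (hq : 1 / 4 ≤ q) (h : q ≤ 8 * π ^ 2 / K) :
    False := by
  have hπ : π < 3.15 := Real.pi_lt_d2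
  have hπ0 : 0 < π := Real.pi_pos
  have hK' : (400 : ℝ) ≤ K := by exact_mod_cast hK
  have h1 : 8 * π ^ 2 / K ≤ 8 * π ^ 2 / 400 :=
    div_le_div_of_nonneg_left (by positivity) (by norm_num) hK'
  nlinarith

/-! ### Case I -/

/-- **Case I of the chamber lemma is impossible.** Let `J ⊆ Ω` be a Jordan loop through `x` all
of whose points either lie on a gate other than `m`, or are far (`‖ψ - c‖ = ε`) and off every
closed gate — in [LSW04] the loop "piece of `A_i`, minimal sub-arc `α'` of the level set `α`,
piece of `A_k`". If `ψ(B₀) ⊆ B̄(c, η)` with `2^K η ≤ ε` and `K ≥ 400`, this is absurd: by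
two-sidedness at `c` (the third gate reaches `∂𝔻`, hence lies outside `ψ ∘ J`) the region `V_m`
maps inside `ψ ∘ J`; every arc of `C(0, u)` launched from `V_m` (for `u` in a window of
logarithmic width `> ¼`) stays off `G`, must leave `Ω`, hence crosses `J` at a far point; and the
length–area bound `∫ du/u ≤ 8π²/K` fails. [cite: LawlerSchrammWerner2004, proof of Lemma 5.4] -/
theorem caseI_false {ε η : ℝ} {K : ℕ} (hη : 0 < η) (hK : 400 ≤ K) (hKε : 2 ^ K * η ≤ ε)
    (hnear : ∀ z ∈ S.B₀, ‖S.ψ z - S.c‖ ≤ η) (m : Fin 3) {J : ℝ → ℂ} (hJ : IsJordanLoop J)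
    (hJΩ : range J ⊆ S.Ω) (hJx : S.x ∈ range J)
    (hJG : ∀ z ∈ range J, (∃ i, i ≠ m ∧ z ∈ S.gate i) ∨ (‖S.ψ z - S.c‖ = ε ∧ ∀ i, z ∉ S.gateC i)) :
    False := by
  have hr := S.r_pos
  have hK1 : 1 ≤ K := le_trans (by norm_num) hK
  have hηε : η < ε := by
    have h2 : (2 : ℝ) ≤ 2 ^ K := by
      calc (2 : ℝ) = 2 ^ 1 := by norm_num
        _ ≤ 2 ^ K := pow_le_pow_right₀ (by norm_num) hK1
    nlinarith
  -- the loop in the disc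
  set j : ℝ → ℂ := S.ψ ∘ J with hj_def
  have hj : IsJordanLoop j := S.isJordanLoop_comp_ψ hJ hJΩ
  have hrj : range j = S.ψ '' range J := range_comp _ _
  have hc : S.c ∈ range j := by
    obtain ⟨t, ht⟩ := hJx
    exact ⟨t, by simp [hj_def, ht, Setup.c]⟩
  have hback : ∀ z ∈ S.Ω, S.ψ z ∈ range j → z ∈ range J := by
    intro z hz hzj
    rw [hrj] at hzj
    obtain ⟨w, hw, hwz⟩ := hzj
    rwa [← S.ψ_injOn (hJΩ hw) hz hwz]
  have hnf : ∀ z ∈ S.B₀, ‖S.ψ z - S.c‖ ≠ ε := fun z hz h ↦ by linarith [hnear z hz]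
  have hloc : ∀ z ∈ ball S.x S.rho, z ∈ S.Ω → S.ψ z ∈ range j → ∃ i, i ≠ m ∧ z ∈ S.gate i := by
    intro z hz hzΩ hzj
    rcases hJG z (hback z hzΩ hzj) with h | ⟨h, -⟩
    · exact h
    · exact absurd h (hnf z (ball_subset_ball S.rho_le_B₀ hz))
  -- the inside of `j` lies in a disc `closedBall 0 R`, `R < 1`
  obtain ⟨R, hR1, hR⟩ := S.exists_image_ψ_subset_closedBall hJ.isCompact_range hJΩ
  have hinsR : IsJordanLoop.inside j ⊆ closedBall 0 R :=
    (hj.inside_subset_ball (by rwa [hrj])).trans ball_subset_closedBall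
  -- the third gate lies outside `j`
  have hgate_out : S.ψ '' (S.gate m \ {S.x}) ⊆ IsJordanLoop.outside j := by
    have hpre := (S.isPreconnected_gate_diff m).image _
      (S.ψ_cont.mono (Set.sdiff_subset.trans (S.gate_subset_Ω m)))
    have havoid : S.ψ '' (S.gate m \ {S.x}) ⊆ (range j)ᶜ := by
      rintro w ⟨z, ⟨hzg, hzx⟩, rfl⟩ hw
      have hzJ := hback z (S.gate_subset_Ω m hzg) hw
      rcases hJG z hzJ with ⟨i, him, hzi⟩ | ⟨-, hnot⟩
      · exact hzx (S.gate_inter_gate_subset him.symm ⟨hzg, hzi⟩)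
      · have : z ∈ S.gateC m := by have h := hzg; rw [S.gate_eq m] at h; exact h.1
        exact hnot m this
    rcases hj.subset_inside_or_subset_outside hpre havoid with hin | hout
    · exact absurd (hin.trans hinsR) (S.not_image_gate_subset_closedBall m hR1)
    · exact hout
  -- the germ `P_m`, hence `V_m`, maps inside `j`
  obtain ⟨g, hg, hgP'⟩ := S.gate_inter_regP'_nonempty m S.rho_pos
  have hPin : S.ψ '' S.regP m S.rho ⊆ IsJordanLoop.inside j :=
    S.image_regP_subset_inside hj hc m hloc S.rho_pos le_rfl
      ⟨S.ψ g, ⟨g, hgP', rfl⟩, hgate_out ⟨g, hg, rfl⟩⟩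
  have hVj : ∀ z ∈ S.V m, S.ψ z ∉ range j := fun z hz h ↦ by
    rcases hJG z (hback z (S.B₀_subset (S.V_subset_B₀ m hz)) h) with ⟨i, -, hzi⟩ | ⟨hfar, -⟩
    · exact Set.disjoint_left.1 (S.disjoint_V_G m) hz (S.gate_subset_G i hzi)
    · exact hnf z (S.V_subset_B₀ m hz) hfar
  obtain ⟨v₀, hv₀, -⟩ := S.V_inter_ball_nonempty m S.rho_pos
  have hVin : S.ψ '' S.V m ⊆ IsJordanLoop.inside j :=
    S.image_subset_inside_of_germ hj S.rho_pos hPin hVj (S.isPreconnected_V m)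
      ((S.V_subset_B₀ m).trans S.B₀_subset) hVj ⟨v₀, hv₀, hv₀⟩
  -- crossing: a launched arc from `V_m` off `G` up to its first exit meets `J` at a far point
  have hcross_of : ∀ (u θ₁ σ' T : ℝ), 0 < u → (σ' = 1 ∨ σ' = -1) → 0 < T → T ≤ 2 * π →
      circleMap 0 u θ₁ ∈ S.V m → circleMap 0 u (θ₁ + σ' * T) ∉ S.Ω →
      (∀ t ∈ Ico 0 T, circleMap 0 u (θ₁ + σ' * t) ∈ S.Ω) →
      (∀ t ∈ Ico 0 T, circleMap 0 u (θ₁ + σ' * t) ∉ S.G) →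
      ∃ a b : ℝ, a ≤ b ∧ b ≤ a + 2 * π ∧ (∀ t ∈ Icc a b, circleMap 0 u t ∈ S.Ω) ∧
        ((‖S.ψ (circleMap 0 u a) - S.c‖ ≤ η ∧ ε ≤ ‖S.ψ (circleMap 0 u b) - S.c‖) ∨
          (‖S.ψ (circleMap 0 u b) - S.c‖ ≤ η ∧ ε ≤ ‖S.ψ (circleMap 0 u a) - S.c‖)) := by
    intro u θ₁ σ' T hu hσ hT0 hT2π hv hexit hin hG
    set p : ℝ → ℂ := fun t ↦ circleMap 0 u (θ₁ + σ' * t) with hp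
    have hpc : Continuous p := by rw [hp]; exact (continuous_circleMap 0 u).comp (by fun_prop)
    have hp0 : p 0 = circleMap 0 u θ₁ := by simp [hp]
    set A : Set ℂ := p '' Ico 0 T with hA
    have hAΩ : A ⊆ S.Ω := by rintro z ⟨t, ht, rfl⟩; exact hin t ht
    have hApre : IsPreconnected (S.ψ '' A) :=
      (isPreconnected_Ico.image _ hpc.continuousOn).image _ (S.ψ_cont.mono hAΩ)
    have hex : ∃ t ∈ Ico 0 T, S.ψ (p t) ∈ range j := by
      by_contra hno
      push Not at hno
      have havoid : S.ψ '' A ⊆ (range j)ᶜ := by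
        rintro w ⟨z, ⟨t, ht, rfl⟩, rfl⟩; exact hno t ht
      have h0A : p 0 ∈ A := ⟨0, ⟨le_rfl, hT0⟩, rfl⟩
      have hAin : S.ψ '' A ⊆ IsJordanLoop.inside j :=
        hj.subset_inside_of_inter_nonempty hApre havoid
          ⟨S.ψ (p 0), ⟨p 0, h0A, rfl⟩, hVin ⟨p 0, by rw [hp0]; exact hv, rfl⟩⟩
      have hcl : p T ∈ closure A := by
        refine image_closure_subset_closure_image hpc ⟨T, ?_, rfl⟩
        rw [closure_Ico hT0.ne]; exact right_mem_Icc.2 hT0.le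
      exact S.not_subset_closedBall_of_mem_closure hAΩ hcl hexit hR1 (hAin.trans hinsR)
    obtain ⟨tc, htc, htcj⟩ := hex
    have hfar : ‖S.ψ (p tc) - S.c‖ = ε := by
      rcases hJG _ (hback _ (hin tc htc) htcj) with ⟨i, -, hzi⟩ | ⟨h, -⟩
      · exact absurd (S.gate_subset_G i hzi) (hG tc htc)
      · exact h
    have hnear0 : ‖S.ψ (circleMap 0 u θ₁) - S.c‖ ≤ η := hnear _ (S.V_subset_B₀ m hv)
    rcases hσ with rfl | rfl
    · refine ⟨θ₁, θ₁ + 1 * tc, by linarith [htc.1], by linarith [htc.2], fun t ht ↦ ?_,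
        Or.inl ⟨hnear0, hfar.symm.le⟩⟩
      have := hin (t - θ₁) ⟨by linarith [ht.1], by linarith [ht.2, htc.2]⟩
      rwa [show θ₁ + 1 * (t - θ₁) = t by ring] at this
    · refine ⟨θ₁ + -1 * tc, θ₁, by linarith [htc.1], by linarith [htc.2], fun t ht ↦ ?_,
        Or.inr ⟨hnear0, hfar.symm.le⟩⟩
      have := hin (θ₁ - t) ⟨by linarith [ht.2], by linarith [ht.1, htc.2]⟩
      rwa [show θ₁ + -1 * (θ₁ - t) = t by ring] at this
  -- inner windows (`m = 1, 2`): launch at `arg x ± δ`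
  have hinner : ∀ σ' : ℝ, (σ' = 1 ∨ σ' = -1) →
      (∀ z ∈ S.B₀ ∩ {z : ℂ | sqn z < S.r}, 0 < σ' * S.side z → z ∈ S.V m) →
      ∀ u ∈ Ioo (0.52 * S.r) S.r,
      ∃ a b : ℝ, a ≤ b ∧ b ≤ a + 2 * π ∧ (∀ t ∈ Icc a b, circleMap 0 u t ∈ S.Ω) ∧
        ((‖S.ψ (circleMap 0 u a) - S.c‖ ≤ η ∧ ε ≤ ‖S.ψ (circleMap 0 u b) - S.c‖) ∨
          (‖S.ψ (circleMap 0 u b) - S.c‖ ≤ η ∧ ε ≤ ‖S.ψ (circleMap 0 u a) - S.c‖)) := by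
    intro σ' hσ hVside u hu
    have hu0 : 0 < u := lt_trans (by positivity) hu.1
    have hσ2 : σ' * σ' = 1 := by rcases hσ with rfl | rfl <;> norm_num
    have hσabs : ∀ s : ℝ, |σ' * s| = |s| := fun s ↦ by
      rcases hσ with rfl | rfl <;> simp
    obtain ⟨δ, hδ, hlaunch⟩ := S.exists_launch hu.1 hu.2
    have hδπ : δ < π := by linarith [hδ.2, Real.pi_gt_three]
    set θ₁ : ℝ := arg S.x + σ' * δ with hθ₁
    -- the launch point is in `V m`
    have hv : circleMap 0 u θ₁ ∈ S.V m := by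
      refine hVside _ (hlaunch (σ' * δ) ?_) ?_
      · rw [mem_Icc, ← abs_le, hσabs, abs_of_pos hδ.1]
      · rw [hθ₁, side_circleMap]
        have hsin : σ' * Real.sin (σ' * δ) = Real.sin δ := by
          rcases hσ with rfl | rfl
          · simp
          · simp [Real.sin_neg]
        have : σ' * (u * ‖S.x‖ * Real.sin (σ' * δ)) = u * ‖S.x‖ * Real.sin δ := by
          rw [← hsin]; ring
        rw [this]
        exact mul_pos (mul_pos hu0 S.norm_x_pos) (Real.sin_pos_of_pos_of_lt_pi hδ.1 hδπ)
    -- the closing piece over `[2π - δ, 2π]` is in `B₀ ⊆ Ω`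
    have hper : ∀ θ : ℝ, circleMap 0 u (θ + σ' * (2 * π)) = circleMap 0 u θ := by
      intro θ
      rcases hσ with rfl | rfl
      · rw [one_mul]; exact periodic_circleMap 0 u θ
      · rw [neg_one_mul, ← sub_eq_add_neg]; exact (periodic_circleMap 0 u).sub_eq θ
    have hclose : ∀ s ∈ Icc (2 * π - δ) (2 * π), circleMap 0 u (θ₁ + σ' * s) ∈ S.Ω := by
      intro s hs
      have h1 : θ₁ + σ' * s = arg S.x + σ' * (δ + s - 2 * π) + σ' * (2 * π) := by rw [hθ₁]; ring
      rw [h1, hper]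
      refine S.B₀_subset (hlaunch _ ?_).1
      rw [mem_Icc, ← abs_le, hσabs, abs_le]
      constructor <;> linarith [hs.1, hs.2]
    obtain ⟨T, hT, hexit, hin⟩ := S.exists_exit hu0 θ₁ σ' hσ hclose
      (S.B₀_subset (S.V_subset_B₀ m hv))
    refine hcross_of u θ₁ σ' T hu0 hσ hT.1 (by linarith [hT.2, hδ.1]) hv hexit hin fun t ht ↦ ?_
    -- off `G`: the angle `σ' (δ + t)` is not a multiple of `2π`
    have h1 : θ₁ + σ' * t = arg S.x + σ' * (δ + t) := by rw [hθ₁]; ring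
    rw [h1]
    refine S.circleMap_notMem_G hu0 hu.2 fun n hn ↦ ?_
    have hpos : 0 < δ + t := by linarith [hδ.1, ht.1]
    have hlt : δ + t < 2 * π := by linarith [ht.2, hT.2]
    have habs : |(n : ℝ) * (2 * π)| = δ + t := by rw [hn, hσabs, abs_of_pos hpos]
    rw [abs_mul, abs_of_pos (by positivity : (0 : ℝ) < 2 * π)] at habs
    -- `|n| 2π = δ + t ∈ (0, 2π)` is impossible for an integer `n`
    rcases eq_or_ne n 0 with rfl | hn0
    · simp at habs; linarith
    · have : (1 : ℝ) ≤ |(n : ℝ)| := by exact_mod_cast Int.one_le_abs hn0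
      nlinarith [Real.pi_pos]
  -- the window `T_m` of logarithmic width `> ¼` with crossings everywhere
  obtain ⟨a, b, ha, hab, hratio, hcross⟩ : ∃ a b : ℝ, 0 < a ∧ a < b ∧ 1 / 4 ≤ (b - a) / b ∧
      ∀ u ∈ Ioo a b, ∃ a' b' : ℝ, a' ≤ b' ∧ b' ≤ a' + 2 * π ∧
        (∀ t ∈ Icc a' b', circleMap 0 u t ∈ S.Ω) ∧
        ((‖S.ψ (circleMap 0 u a') - S.c‖ ≤ η ∧ ε ≤ ‖S.ψ (circleMap 0 u b') - S.c‖) ∨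
          (‖S.ψ (circleMap 0 u b') - S.c‖ ≤ η ∧ ε ≤ ‖S.ψ (circleMap 0 u a') - S.c‖)) := by
    match m with
    | 0 =>
      refine ⟨1.42 * S.r, 1.9 * S.r, by positivity, by linarith, ?_, fun u hu ↦ ?_⟩
      · rw [le_div_iff₀ (by positivity)]; linarith
      · have hu0 : 0 < u := lt_trans (by positivity) hu.1
        have hv : circleMap 0 u (arg S.x) ∈ S.V 0 := S.circleMap_arg_x_mem_V hu.1 hu.2
        have hclose : ∀ s ∈ Icc (2 * π) (2 * π), circleMap 0 u (arg S.x + 1 * s) ∈ S.Ω := by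
          intro s hs
          have : s = 2 * π := le_antisymm hs.2 hs.1
          rw [this, one_mul, periodic_circleMap]
          exact S.B₀_subset (S.V_subset_B₀ 0 hv)
        obtain ⟨T, hT, hexit, hin⟩ := S.exists_exit hu0 (arg S.x) 1 (Or.inl rfl) hclose
          (S.B₀_subset (S.V_subset_B₀ 0 hv))
        refine hcross_of u (arg S.x) 1 T hu0 (Or.inl rfl) hT.1 hT.2 hv hexit hin fun t _ ↦ ?_
        refine S.notMem_G_of_sq_lt ?_
        rw [norm_circleMap_zero, abs_of_pos hu0]
        nlinarith [hu.1]
    | 1 =>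
      refine ⟨0.52 * S.r, S.r, by positivity, by linarith, ?_, ?_⟩
      · rw [le_div_iff₀ hr]; linarith
      · refine hinner (-1) (Or.inr rfl) fun z hz hside ↦ ?_
        exact ⟨hz, by show S.side z < 0; linarith⟩
    | 2 =>
      refine ⟨0.52 * S.r, S.r, by positivity, by linarith, ?_, ?_⟩
      · rw [le_div_iff₀ hr]; linarith
      · refine hinner 1 (Or.inl rfl) fun z hz hside ↦ ?_
        exact ⟨hz, by show 0 < S.side z; linarith⟩
  -- length–area
  have hle := LogScaleLengthArea.lintegral_inv_le_of_crossings S.isOpen S.ψ_diff S.ψ_injOn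
    (c := S.c) (p := 0) hη hK1 hKε measurableSet_Ioo (fun u hu ↦ ha.trans hu.1) hcross
  have hge := lintegral_inv_Ioo_ge ha hab
  have h := hge.trans hle
  rw [ENNReal.ofReal_le_ofReal_iff (by positivity)] at h
  exact false_of_ratio hK hratio h

end Setup

end ThreeChamber

end Literature.Analysis.Complex
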